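import Summits.ResolutionOfSingularities.KangarooAtlas.MizutaniProfileOps
import HarnessLib

/-!
# Mizutani's conjecture `m(e) = 2p^e − 1` — the CLEAN LAYER LEMMA

Cell topic `Summits/ResolutionOfSingularities/KangarooAtlas` (pub-rosobs); namespace
`Summit.ResolutionOfSingularities.KangarooAtlas.Mizutani`.  Part of the Lean transcription of the
in-house note MIZUTANI-PROOF-g59 (AI-written, AI-audited, NOT refereed; *AI review is weaker than expert
review*); nothing here is a resolution theorem.

## Content (encloser-1 ARCH-e1 (Λ); replaces MIZUTANI-PROOF-g59 §7 slice lemma + layer lemma)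

For a coordinate `c` and a height `h`, the LAYER EXTRACTION
`layer c h : MvPolynomial (Fin (n+1)) k →ₗ[k] MvPolynomial (Fin n) k`, `X^M ↦ [M_c = h] · X^{M'}`
(`M'` = `M` with the `c`-th entry removed) is `k`-linear and INTERTWINES the profile operators:
`layer c h (E_T f) = E'_{T'} (layer c h f)` for `T = T'` with a `0` inserted at `c`
(`layer_opE`), where `E'` is built from the restricted operator family `restrictD c D T' = D T`.
Consequently (`eProfile_layer_le`) `σ_i(f) ≥ σ'_i(LAYER_{c,h} f)`: the profile of `f` in `s = n+1`
variables dominates the profile of its `(c,h)`-layer in `n` variables — in EVERY tower and for EVERY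
height `h`, with no torus degeneration, no slice decomposition and no unit-constant-term hypothesis (the
note needs all three because it reads the layer through the intrinsic `Diff`-description; in the
left-coefficient model the operators `E_T` with `T_c = 0` simply never touch the `c`-th exponent).

Also here: `opE` as a `Finsupp.sum` (`opE_eq_sum`), additivity (`opE_add`) and the value on a monomial
(`opE_monomial`).

References: [Mizutani1973HironakaGroupSchemes] (Remark 2.10; in-house proof §7);
[Oda1983HironakaGroupSchemeII] §1; [EGAIV4] Thm. 16.11.2.
-/

open MvPolynomial

namespace Summit.ResolutionOfSingularities.KangarooAtlas.Mizutani

/-! ## `E_T` is additive; its value on monomials -/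

section OpE

variable {ι : Type*} [DecidableEq ι] {k : Type*} [CommRing k]

omit [DecidableEq ι] in
/-- Sums of an additive coefficient functional over the support may be taken over any larger finite
set. [folklore] -/
theorem sum_support_subset {A : Type*} [AddCommMonoid A] (F : (ι →₀ ℕ) → k →+ A)
    (f : MvPolynomial ι k) {S : Finset (ι →₀ ℕ)} (hS : f.support ⊆ S) :
    ∑ M ∈ f.support, F M (coeff M f) = ∑ M ∈ S, F M (coeff M f) :=
  Finset.sum_subset hS fun M _ hM => by rw [notMem_support_iff.mp hM, map_zero]

/-- The summand of `E_T` as an additive map of the coefficient. [cite: EGAIV4, Thm. 16.11.2] -/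
noncomputable def opETerm (D : (ι →₀ ℕ) → k →+ k) (T M : ι →₀ ℕ) : k →+ MvPolynomial ι k where
  toFun κ := ∑ x ∈ Finset.antidiagonal T, monomial (M - x.2) ((mchoose M x.2 : k) * D x.1 κ)
  map_zero' := by simp
  map_add' a b := by
    rw [← Finset.sum_add_distrib]
    refine Finset.sum_congr rfl fun x _ => ?_
    rw [← map_add, map_add, mul_add]

/-- `E_T f` as a sum of the additive summands over the support. [cite: EGAIV4, Thm. 16.11.2] -/
theorem opE_eq_sum (D : (ι →₀ ℕ) → k →+ k) (T : ι →₀ ℕ) (f : MvPolynomial ι k) :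
    opE D T f = ∑ M ∈ f.support, opETerm D T M (coeff M f) := rfl

/-- **`E_T` on a monomial**: `E_T (κ X^M) = Σ_{T₁+T₂=T} C(M,T₂) D_{T₁}(κ) X^{M−T₂}`
(MIZUTANI-PROOF-g59 §1.4). [cite: EGAIV4, Thm. 16.11.2 (16.11.2.1)–(16.11.2.2)] -/
theorem opE_monomial (D : (ι →₀ ℕ) → k →+ k) (T M : ι →₀ ℕ) (κ : k) :
    opE D T (monomial M κ) =
      ∑ x ∈ Finset.antidiagonal T, monomial (M - x.2) ((mchoose M x.2 : k) * D x.1 κ) := by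
  classical
  rw [opE_eq_sum, sum_support_subset (opETerm D T) _ (support_monomial_subset (s := M) (a := κ)),
    Finset.sum_singleton, coeff_monomial, if_pos rfl]
  rfl

/-- `E_T` is additive. [cite: EGAIV4, Thm. 16.11.2] -/
theorem opE_add (D : (ι →₀ ℕ) → k →+ k) (T : ι →₀ ℕ) (f g : MvPolynomial ι k) :
    opE D T (f + g) = opE D T f + opE D T g := by
  classical
  rw [opE_eq_sum, opE_eq_sum, opE_eq_sum,
    sum_support_subset (opETerm D T) (f + g) (support_add (p := f) (q := g)),
    sum_support_subset (opETerm D T) f (Finset.subset_union_left (s₂ := g.support)),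
    sum_support_subset (opETerm D T) g (Finset.subset_union_right (s₁ := f.support)),
    ← Finset.sum_add_distrib]
  refine Finset.sum_congr rfl fun M _ => ?_
  rw [coeff_add, map_add]

/-- `E_T 0 = 0`. [cite: EGAIV4, Thm. 16.11.2] -/
@[simp] theorem opE_zero_right (D : (ι →₀ ℕ) → k →+ k) (T : ι →₀ ℕ) :
    opE D T (0 : MvPolynomial ι k) = 0 := by
  rw [opE_eq_sum, support_zero, Finset.sum_empty]

/-- `E_T` commutes with finite sums. [cite: EGAIV4, Thm. 16.11.2] -/
theorem opE_finset_sum (D : (ι →₀ ℕ) → k →+ k) (T : ι →₀ ℕ) {α : Type*} (s : Finset α)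
    (g : α → MvPolynomial ι k) : opE D T (∑ a ∈ s, g a) = ∑ a ∈ s, opE D T (g a) := by
  classical
  induction s using Finset.induction_on with
  | empty => simp
  | insert a s ha ih => rw [Finset.sum_insert ha, Finset.sum_insert ha, opE_add, ih]

end OpE

/-! ## Inserting and removing a coordinate -/

section InsertRemove

variable {n : ℕ}

/-- Insert the value `h` at coordinate `c`. [folklore] -/
noncomputable def insertAt (c : Fin (n + 1)) (h : ℕ) (N : Fin n →₀ ℕ) : Fin (n + 1) →₀ ℕ :=
  Finsupp.equivFunOnFinite.symm (Fin.insertNth c h ⇑N)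

/-- Remove coordinate `c`. [folklore] -/
noncomputable def removeAt (c : Fin (n + 1)) (M : Fin (n + 1) →₀ ℕ) : Fin n →₀ ℕ :=
  Finsupp.equivFunOnFinite.symm (Fin.removeNth c ⇑M)

/-- The inserted value sits at `c`. [folklore] -/
@[simp] theorem insertAt_apply_same (c : Fin (n + 1)) (h : ℕ) (N : Fin n →₀ ℕ) :
    insertAt c h N c = h := by
  simp [insertAt]

/-- Away from `c` the inserted vector is the old one. [folklore] -/
@[simp] theorem insertAt_apply_succAbove (c : Fin (n + 1)) (h : ℕ) (N : Fin n →₀ ℕ) (j : Fin n) :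
    insertAt c h N (c.succAbove j) = N j := by
  simp [insertAt]

/-- Components of `removeAt`. [folklore] -/
@[simp] theorem removeAt_apply (c : Fin (n + 1)) (M : Fin (n + 1) →₀ ℕ) (j : Fin n) :
    removeAt c M j = M (c.succAbove j) := by
  simp [removeAt, Fin.removeNth]

/-- `removeAt c (insertAt c h N) = N`. [folklore] -/
@[simp] theorem removeAt_insertAt (c : Fin (n + 1)) (h : ℕ) (N : Fin n →₀ ℕ) :
    removeAt c (insertAt c h N) = N := by
  ext j; simp

/-- `insertAt c (M c) (removeAt c M) = M`. [folklore] -/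
theorem insertAt_removeAt (c : Fin (n + 1)) (M : Fin (n + 1) →₀ ℕ) :
    insertAt c (M c) (removeAt c M) = M := by
  ext j
  refine Fin.succAboveCases c ?_ (fun j => ?_) j
  · simp
  · simp

/-- `insertAt c h` is injective. [folklore] -/
theorem insertAt_injective (c : Fin (n + 1)) (h : ℕ) : Function.Injective (insertAt c h) := by
  intro A B hAB
  have := congrArg (removeAt c) hAB
  simpa using this

/-- `insertAt` is additive in both arguments. [folklore] -/
theorem insertAt_add (c : Fin (n + 1)) (h h' : ℕ) (A B : Fin n →₀ ℕ) :
    insertAt c (h + h') (A + B) = insertAt c h A + insertAt c h' B := by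
  ext j
  refine Fin.succAboveCases c ?_ (fun j => ?_) j
  · simp
  · simp

/-- `removeAt` is additive. [folklore] -/
theorem removeAt_add (c : Fin (n + 1)) (A B : Fin (n + 1) →₀ ℕ) :
    removeAt c (A + B) = removeAt c A + removeAt c B := by
  ext j; simp

/-- `removeAt` commutes with truncated subtraction. [folklore] -/
theorem removeAt_tsub (c : Fin (n + 1)) (A B : Fin (n + 1) →₀ ℕ) :
    removeAt c (A - B) = removeAt c A - removeAt c B := by
  ext j; simp

/-- `insertAt c 0` commutes with truncated subtraction against an inserted vector. [folklore] -/
theorem insertAt_tsub (c : Fin (n + 1)) (h : ℕ) (A B : Fin n →₀ ℕ) :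
    insertAt c h A - insertAt c 0 B = insertAt c h (A - B) := by
  ext j
  refine Fin.succAboveCases c ?_ (fun j => ?_) j
  · simp
  · simp

/-- Degree of an inserted vector. [folklore] -/
theorem degree_insertAt (c : Fin (n + 1)) (h : ℕ) (N : Fin n →₀ ℕ) :
    (insertAt c h N).degree = h + N.degree := by
  rw [Finsupp.degree_eq_sum, Finsupp.degree_eq_sum, Fin.sum_univ_succAbove _ c]
  simp

/-- The multi-binomial of inserted vectors. [folklore] -/
theorem mchoose_insertAt (c : Fin (n + 1)) (h h' : ℕ) (M T : Fin n →₀ ℕ) :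
    mchoose (insertAt c h M) (insertAt c h' T) = h.choose h' * mchoose M T := by
  rw [mchoose_eq_prod, mchoose_eq_prod, Fin.prod_univ_succAbove _ c]
  simp

/-- The antidiagonal of an inserted vector with `0` at `c` is the image of the antidiagonal.
[folklore] -/
theorem mem_antidiagonal_insertAt_zero (c : Fin (n + 1)) (T : Fin n →₀ ℕ)
    (x : (Fin (n + 1) →₀ ℕ) × (Fin (n + 1) →₀ ℕ)) :
    x ∈ Finset.antidiagonal (insertAt c 0 T) ↔
      ∃ y ∈ Finset.antidiagonal T, x = (insertAt c 0 y.1, insertAt c 0 y.2) := by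
  constructor
  · intro hx
    rw [Finset.mem_antidiagonal] at hx
    have hc : x.1 c + x.2 c = 0 := by
      have := congrArg (fun f => f c) hx
      simpa using this
    refine ⟨(removeAt c x.1, removeAt c x.2), ?_, ?_⟩
    · rw [Finset.mem_antidiagonal, ← removeAt_add, hx, removeAt_insertAt]
    · have h1 : x.1 c = 0 := by omega
      have h2 : x.2 c = 0 := by omega
      refine Prod.ext ?_ ?_
      · conv_lhs => rw [← insertAt_removeAt c x.1, h1]
      · conv_lhs => rw [← insertAt_removeAt c x.2, h2]
  · rintro ⟨y, hy, rfl⟩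
    rw [Finset.mem_antidiagonal] at hy ⊢
    simp only
    rw [← insertAt_add, hy]

end InsertRemove

/-! ## The layer extraction and the intertwining -/

section Layer

variable {n : ℕ} {k : Type*} [CommRing k]

/-- The summand of the layer extraction as an additive map of the coefficient. [folklore] -/
noncomputable def layerTerm (c : Fin (n + 1)) (h : ℕ) (M : Fin (n + 1) →₀ ℕ) :
    k →+ MvPolynomial (Fin n) k where
  toFun κ := if M c = h then monomial (removeAt c M) κ else 0
  map_zero' := by split_ifs <;> simp
  map_add' a b := by split_ifs <;> simp

/-- **Layer extraction** `X^M ↦ [M_c = h] X^{M'}` as a `k`-linear map (MIZUTANI-PROOF-g59 §7,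
`L_{c,h}`; encloser-1 ARCH-e1 (Λ)). [cite: Mizutani1973HironakaGroupSchemes, Remark 2.10 (in-house proof §7, layers)] -/
noncomputable def layer (c : Fin (n + 1)) (h : ℕ) :
    MvPolynomial (Fin (n + 1)) k →ₗ[k] MvPolynomial (Fin n) k where
  toFun f := ∑ M ∈ f.support, layerTerm c h M (coeff M f)
  map_add' f g := by
    classical
    rw [sum_support_subset (layerTerm c h) (f + g) (support_add (p := f) (q := g)),
      sum_support_subset (layerTerm c h) f (Finset.subset_union_left (s₂ := g.support)),
      sum_support_subset (layerTerm c h) g (Finset.subset_union_right (s₁ := f.support)),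
      ← Finset.sum_add_distrib]
    refine Finset.sum_congr rfl fun M _ => ?_
    rw [coeff_add, map_add]
  map_smul' a f := by
    classical
    rw [sum_support_subset (layerTerm c h) (a • f) (support_smul (f := f) (a := a)),
      RingHom.id_apply, Finset.smul_sum]
    refine Finset.sum_congr rfl fun M _ => ?_
    rw [coeff_smul]
    show (if M c = h then _ else _) = a • (if M c = h then _ else _)
    split_ifs <;> simp [smul_monomial]

/-- The layer of a monomial. [cite: Mizutani1973HironakaGroupSchemes, Remark 2.10 (in-house proof §7)] -/
theorem layer_monomial (c : Fin (n + 1)) (h : ℕ) (M : Fin (n + 1) →₀ ℕ) (κ : k) :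
    layer c h (monomial M κ) = if M c = h then monomial (removeAt c M) κ else 0 := by
  classical
  show ∑ M' ∈ (monomial M κ).support, layerTerm c h M' (coeff M' (monomial M κ)) = _
  rw [sum_support_subset (layerTerm c h) _ (support_monomial_subset (s := M) (a := κ)),
    Finset.sum_singleton, coeff_monomial, if_pos rfl]
  rfl

/-- **Coefficients of the layer**: `coeff_N (layer c h f) = coeff_{ins_c h N} f`.
[cite: Mizutani1973HironakaGroupSchemes, Remark 2.10 (in-house proof §7)] -/
theorem coeff_layer (c : Fin (n + 1)) (h : ℕ) (f : MvPolynomial (Fin (n + 1)) k) (N : Fin n →₀ ℕ) :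
    coeff N (layer c h f) = coeff (insertAt c h N) f := by
  induction f using MvPolynomial.induction_on' with
  | monomial M κ =>
    rw [layer_monomial, coeff_monomial]
    by_cases hM : M c = h
    · rw [if_pos hM, coeff_monomial]
      by_cases hMN : removeAt c M = N
      · rw [if_pos hMN, if_pos]
        rw [← hMN, ← hM, insertAt_removeAt]
      · rw [if_neg hMN, if_neg]
        intro hMN'
        apply hMN
        rw [hMN', removeAt_insertAt]
    · rw [if_neg hM, coeff_zero, if_neg]
      intro hMN
      apply hM
      rw [hMN, insertAt_apply_same]
  | add f g hf hg => rw [map_add, coeff_add, coeff_add, hf, hg]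

/-- Support of the layer: `N ∈ supp (layer c h f) ↔ ins_c h N ∈ supp f`.
[cite: Mizutani1973HironakaGroupSchemes, Remark 2.10 (in-house proof §7)] -/
theorem mem_support_layer (c : Fin (n + 1)) (h : ℕ) (f : MvPolynomial (Fin (n + 1)) k)
    (N : Fin n →₀ ℕ) : N ∈ (layer c h f).support ↔ insertAt c h N ∈ f.support := by
  rw [mem_support_iff, mem_support_iff, coeff_layer]

/-- The operator family restricted to multi-indices with `T_c = 0`: `D' T' := D (ins_c 0 T')` — the
Hasse–Schmidt data of the `(s−1)`-tower `k ⊃ L(a_c)` (MIZUTANI-PROOF-g59 §7 SETTING).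
[cite: Mizutani1973HironakaGroupSchemes, Remark 2.10 (in-house proof §7, the (s−1)-tower)] -/
noncomputable def restrictD (c : Fin (n + 1)) (D : (Fin (n + 1) →₀ ℕ) → k →+ k) : (Fin n →₀ ℕ) → k →+ k :=
  fun T => D (insertAt c 0 T)

/-- `restrictD` keeps `D 0 = id`. [folklore] -/
theorem restrictD_zero (c : Fin (n + 1)) (D : (Fin (n + 1) →₀ ℕ) → k →+ k)
    (hD0 : D 0 = AddMonoidHom.id k) : restrictD c D 0 = AddMonoidHom.id k := by
  unfold restrictD
  convert hD0
  ext j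
  refine Fin.succAboveCases c ?_ (fun j => ?_) j <;> simp

/-- **INTERTWINING** (encloser-1 ARCH-e1 (Λ)): `layer c h (E_{ins_c 0 T} f) = E'_T (layer c h f)` with `E'`
built from `restrictD c D` — the operators `E_T` with `T_c = 0` never change the `c`-th exponent.
[cite: Mizutani1973HironakaGroupSchemes, Remark 2.10 (in-house proof §7, slice lemma (i) and layer lemma)] -/
theorem layer_opE (c : Fin (n + 1)) (h : ℕ) (D : (Fin (n + 1) →₀ ℕ) → k →+ k) (T : Fin n →₀ ℕ)
    (f : MvPolynomial (Fin (n + 1)) k) :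
    layer c h (opE D (insertAt c 0 T) f) = opE (restrictD c D) T (layer c h f) := by
  classical
  induction f using MvPolynomial.induction_on' with
  | monomial M κ =>
    rw [opE_monomial, map_sum, layer_monomial]
    by_cases hM : M c = h
    · rw [if_pos hM, opE_monomial]
      -- reindex the antidiagonal of `ins_c 0 T` by the antidiagonal of `T`
      symm
      refine Finset.sum_nbij' (fun y => (insertAt c 0 y.1, insertAt c 0 y.2))
        (fun x => (removeAt c x.1, removeAt c x.2)) ?_ ?_ ?_ ?_ ?_
      · intro y hy
        exact (mem_antidiagonal_insertAt_zero c T _).mpr ⟨y, hy, rfl⟩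
      · intro x hx
        obtain ⟨y, hy, rfl⟩ := (mem_antidiagonal_insertAt_zero c T x).mp hx
        simpa using hy
      · intro y _
        simp
      · intro x hx
        obtain ⟨y, _, rfl⟩ := (mem_antidiagonal_insertAt_zero c T x).mp hx
        simp
      · intro y _
        simp only
        rw [layer_monomial, if_pos, removeAt_tsub, removeAt_insertAt]
        · congr 1
          unfold restrictD
          rw [← insertAt_removeAt c M, hM, mchoose_insertAt, Nat.choose_zero_right, one_mul,
            removeAt_insertAt]
        · rw [Finsupp.tsub_apply, insertAt_apply_same, hM, Nat.sub_zero]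
    · rw [if_neg hM, opE_zero_right]
      refine Finset.sum_eq_zero fun x hx => ?_
      rw [layer_monomial, if_neg]
      obtain ⟨y, _, rfl⟩ := (mem_antidiagonal_insertAt_zero c T x).mp hx
      simp only [Finsupp.tsub_apply, insertAt_apply_same, Nat.sub_zero]
      exact hM
  | add f g hf hg => rw [opE_add, map_add, map_add, opE_add, hf, hg]

end Layer

/-! ## The profile of the layer is dominated by the profile -/

section Profile

variable {n : ℕ} {k : Type*} [Field k]

/-- The layer's profile span is the image of a sub-span of the profile span.
[cite: Mizutani1973HironakaGroupSchemes, Remark 2.10 (in-house proof §7, layer lemma)] -/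
theorem eSpan_layer_le (c : Fin (n + 1)) (h : ℕ) (D : (Fin (n + 1) →₀ ℕ) → k →+ k) (i : ℕ)
    (f : MvPolynomial (Fin (n + 1)) k) :
    eSpan (restrictD c D) i (layer c h f) ≤ (eSpan D i f).map (layer c h) := by
  unfold eSpan
  rw [Submodule.span_le]
  rintro g ⟨T, hT, rfl⟩
  have hT' : (insertAt c 0 T).degree ≤ i := by
    rw [degree_insertAt, zero_add]; exact mem_degLE.mp (Finset.mem_coe.mp hT)
  show opE (restrictD c D) T (layer c h f) ∈ _
  rw [← layer_opE]
  exact Submodule.mem_map_of_mem (Submodule.subset_span ⟨insertAt c 0 T,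
    Finset.mem_coe.mpr (mem_degLE.mpr hT'), rfl⟩)

/-- **CLEAN LAYER LEMMA** (encloser-1 ARCH-e1 (Λ); MIZUTANI-PROOF-g59 §7 LAYER LEMMA without degeneration):
`σ_i(f) ≥ σ'_i(LAYER_{c,h} f)` for every coordinate `c`, every height `h`, every coefficient field and every
operator family. [cite: Mizutani1973HironakaGroupSchemes, Remark 2.10 (in-house proof §7, layer lemma)] -/
theorem eProfile_layer_le (c : Fin (n + 1)) (h : ℕ) (D : (Fin (n + 1) →₀ ℕ) → k →+ k) (i : ℕ)
    (f : MvPolynomial (Fin (n + 1)) k) :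
    eProfile (restrictD c D) i (layer c h f) ≤ eProfile D i f := by
  unfold eProfile
  haveI := eSpan_finite D i f
  calc Module.finrank k (eSpan (restrictD c D) i (layer c h f))
      ≤ Module.finrank k ((eSpan D i f).map (layer c h)) :=
        Submodule.finrank_mono (eSpan_layer_le c h D i f)
    _ ≤ Module.finrank k (eSpan D i f) := Submodule.finrank_map_le _ _

end Profile

end Summit.ResolutionOfSingularities.KangarooAtlas.Mizutani
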